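import Literature.MathematicalPhysics.QuantumFieldTheory.BalabanImbrieJaffe1984to88.BIJ88Close218Proof

/-!
# `BalabanImbrieJaffe1984to88.BIJ88Ineq238Proof` — T. Bałaban, J. Imbrie, A. Jaffe, *Effective action and cluster properties of the
abelian Higgs model*, Commun. Math. Phys. **114** (1988) 257–315 [BalabanImbrieJaffe1988]: the hence-step of p. 264, *"in view of (2.35),
the lower bound (I.7.3.2) applies to Δ_{k,loc}(u) as well"* ⟹ (2.38) — PROVED as quadratic-form algebra (complex Schur bound), with
the constants explicit

statement-level skeleton of published theorems with citation tags; proofs where landed; nothing here is a claim about the Yang–Mills mass gap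

PDF held: `paper:balaban1988-cmp114-bij-abelian-higgs-effective-action` (journal page = PDF page + 256); p. 264 [PDF 8] read this session from
the text layer (`lit read … --pages 7-9`).

WHAT IS REPRODUCED.  SKELETON row **C2.Eq2.38** (cell `lit-balaban`, HOME `run/shared/lean/pub/lit-balaban/`; Phase-2 seat p02 gen 3 = unit
`lit-balaban-p02`, G.2(b)/(c) knitting step, companion of `BIJ88Close235Proof` (p248026, (2.35)) and `BIJ88Close218Proof` (p248140, the Schur
bound); C2 §§1–4 fold owner r18, referee ref-5; TAKING line HOME/STATUS.md 2026-08-21T04:32:32Z).  Before this file (2.38) was the bare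
`def … : Prop` `BIJ88Sect2Statements.Ineq238` (typed p239939, on the `Setup` tori).
p. 264, verbatim: *"Again we assume u is smooth in the relevant regions; Δ_{k,loc}(u;x₁,x₂) depends on u only in an O(r(e_k))-neighborhood of
x₁, x₂. Finally, in view of (2.35), the lower bound (I.7.3.2) applies to Δ_{k,loc}(u) as well. Let φ be supported in a region having an r(e_k)
neighborhood where u is smooth. Then ⟨φ, Δ_{k,loc}(u)φ⟩ ≧ c Σ_{b∈T₁^{(k)*}} |u(⟨b₋,b₊⟩)φ(b₊) − φ(b₋)|² − ce_k²p(e_k)² Σ_{x∈T₁^{(k)}} |φ(x)|².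
(2.38)"*; (2.35) p. 263: *"|Δ_{k,loc}(u;x₁,x₂) − Δ_k(Ω,u;x₁,x₂)| ≦ e^{−cr(e_k)}e^{−c|x₁−x₂|} for dist({x₁,x₂},Ω^c) > O(r(e_k))"*.

WHAT IS PROVED HERE (0 `sorry`, standard axioms).
§1 THE QUADRATIC FORM OF A KERNEL on complex site fields, `kform K φ = Re Σ_{x,y} conj(φ(x))K(x,y)φ(y)` (complex kernels — the covariant
`Δ_k(Ω,u)`, `Δ_{k,loc}(u)` are Hermitian complex kernels; r18's real kernels enter through `rkform`), and the COMPLEX SCHUR STEP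
`abs_kform_sub_le`: if `‖K_loc(x,y) − K(x,y)‖ ≤ δe^{−c′dist(x,y)}` for `x, y ∈ supp φ` (symmetric `dist`, weight row sums `≤ S`), then
`|kform K_loc φ − kform K φ| ≤ δS·Σ_x|φ(x)|²` (via p248140's real `BIJ88Close218Proof.abs_form_le_of_kernel_bound` applied to `|φ|`).
§2 THE HENCE-STEP.  `ineq238_of_formClose`: r18's `Ineq238 c e_k p(e_k) form_Ω Adm u` ([I] (7.3.2) for Δ_k(Ω,u), a statement row) and any form
closeness `|form_loc φ − form_Ω φ| ≤ η‖φ‖²` on admissible φ give the TWO-CONSTANT lower bound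
`c·Σ_b|u(b)φ(b₊) − φ(b₋)|² − (c·e_k²p(e_k)² + η)·Σ_x|φ(x)|² ≤ form_loc φ`; **`ineq238_loc_of_close235`**: with `form = rkform` of real kernels
and (2.35) `Close235 dist Far Δ_loc Δ_Ω c′ r(e_k)` whose region contains `supp φ × supp φ` for admissible φ (print: *"φ supported in a region
having an r(e_k) neighborhood where u is smooth"*), η = `e^{−c′r(e_k)}·S`; `ineq238_loc_of_kernelClose` the same for complex kernels.
READING NOTE (typing level, recorded in HOME/GAPS.md by this seat; nothing fails in the kernel): print's generic `c` appears twice in (2.38)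
(and as prefactor AND rate in (2.36)); r18's one-letter transcriptions `Ineq238 c …` / `Decay … c` are therefore not closed under the printed
hence-steps — absorbing the (2.35) error `e^{−cr(e_k)}S‖φ‖²` into `ce_k²p(e_k)²‖φ‖²` raises the second constant while the first must not
rise — so the derived statements here carry the two constants explicitly; a one-letter `Ineq238 c′ …` conclusion would need `c′ ≤ c` and
`c′ ≥ c + η/(e_k²p(e_k)²)` at once.
HONEST SCOPE.  (I.7.3.2) and (2.35) are displayed hypotheses (statement rows C1.Eq7.3.2 / C2.Eq2.35, the latter derived from (2.31) in
`BIJ88Close235Proof`); the smoothness of u and the support condition are the abstract `Adm`/`Far`; nothing on d = 4 or the continuum;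
NOT summit progress.
-/

namespace Literature.MathematicalPhysics.QuantumFieldTheory.BalabanImbrieJaffe1984to88.BIJ88Ineq238Proof

open Finset BIJ88Sect2Statements

noncomputable section

/-! ## §1  The quadratic form of a kernel on complex site fields; the complex Schur step -/

section Form

variable {α : Type*} [Fintype α]

/-- The quadratic form of a complex kernel on complex site fields, `⟨φ, Kφ⟩ = Re Σ_{x,y} conj(φ(x))K(x,y)φ(y)` (real part; for a Hermitian
kernel the sum is already real). [cite: BalabanImbrieJaffe1988, (2.38) p.264] -/
def kform (K : α → α → ℂ) (φ : α → ℂ) : ℝ := ∑ x, ∑ y, (starRingEnd ℂ (φ x) * K x y * φ y).re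

/-- The same for r18's real kernels (`Close235`, `Decay` are typed over `α → α → ℝ`). [cite: BalabanImbrieJaffe1988, (2.38) p.264] -/
def rkform (K : α → α → ℝ) (φ : α → ℂ) : ℝ := kform (fun x y => (K x y : ℂ)) φ

/-- The difference of two forms is the form of the kernel difference. [cite: BalabanImbrieJaffe1988, (2.38) p.264] -/
theorem kform_sub (K K' : α → α → ℂ) (φ : α → ℂ) :
    kform K φ - kform K' φ = ∑ x, ∑ y, (starRingEnd ℂ (φ x) * (K x y - K' x y) * φ y).re := by
  simp only [kform, ← Finset.sum_sub_distrib, ← Complex.sub_re]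
  refine Finset.sum_congr rfl fun x _ => Finset.sum_congr rfl fun y _ => ?_
  ring_nf

/-- **Complex Schur step**: a kernel difference dominated by `δe^{−c′dist}` on `supp φ × supp φ` (symmetric `dist`, weight row sums `≤ S`)
moves the form by at most `δS‖φ‖²`. [cite: BalabanImbrieJaffe1988, (2.38) p.264] -/
theorem abs_kform_sub_le {dist : α → α → ℝ} {K K' : α → α → ℂ} {δ c' S : ℝ} {φ : α → ℂ}
    (hM : ∀ x y, φ x ≠ 0 → φ y ≠ 0 → ‖K x y - K' x y‖ ≤ δ * Real.exp (-c' * dist x y))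
    (hsymm : ∀ x y, dist x y = dist y x) (hS : ∀ x, ∑ y, Real.exp (-c' * dist x y) ≤ S) (hδ : 0 ≤ δ) :
    |kform K φ - kform K' φ| ≤ δ * S * ∑ x, ‖φ x‖ ^ 2 := by
  classical
  -- the dominating real kernel, cut to the support of φ
  set M : α → α → ℝ := fun x y => if φ x ≠ 0 ∧ φ y ≠ 0 then ‖K x y - K' x y‖ else 0 with hMdef
  have hMbd : ∀ x y, |M x y| ≤ δ * Real.exp (-c' * dist x y) := by
    intro x y
    simp only [hMdef]
    split_ifs with h
    · rw [abs_of_nonneg (norm_nonneg _)]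
      exact hM x y h.1 h.2
    · rw [abs_zero]
      positivity
  have hMnn : ∀ x y, 0 ≤ M x y := fun x y => by
    simp only [hMdef]
    split_ifs <;> positivity
  have hpt : ∀ x y, |(starRingEnd ℂ (φ x) * (K x y - K' x y) * φ y).re| ≤ ‖φ x‖ * (M x y * ‖φ y‖) := by
    intro x y
    by_cases h : φ x ≠ 0 ∧ φ y ≠ 0
    · have hMxy : M x y = ‖K x y - K' x y‖ := by simp only [hMdef, if_pos h]
      rw [hMxy]
      refine (Complex.abs_re_le_norm _).trans ?_
      rw [norm_mul, norm_mul, Complex.norm_conj]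
      exact le_of_eq (by ring)
    · have h0 : starRingEnd ℂ (φ x) * (K x y - K' x y) * φ y = 0 := by
        rw [not_and_or, not_not, not_not] at h
        rcases h with h | h
        · simp [h]
        · simp [h]
      rw [h0, Complex.zero_re, abs_zero]
      have := hMnn x y
      positivity
  have hreal := BIJ88Close218Proof.abs_form_le_of_kernel_bound (M := M) hMbd hsymm hS hδ (fun x => ‖φ x‖)
  rw [kform_sub]
  calc |∑ x, ∑ y, (starRingEnd ℂ (φ x) * (K x y - K' x y) * φ y).re|
      ≤ ∑ x, ∑ y, |(starRingEnd ℂ (φ x) * (K x y - K' x y) * φ y).re| :=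
        (Finset.abs_sum_le_sum_abs _ _).trans (Finset.sum_le_sum fun x _ => Finset.abs_sum_le_sum_abs _ _)
    _ ≤ ∑ x, ∑ y, ‖φ x‖ * (M x y * ‖φ y‖) := Finset.sum_le_sum fun x _ => Finset.sum_le_sum fun y _ => hpt x y
    _ = ∑ x, ‖φ x‖ * applyK M (fun y => ‖φ y‖) x := by
        simp only [applyK, Finset.mul_sum]
    _ ≤ |∑ x, ‖φ x‖ * applyK M (fun y => ‖φ y‖) x| := le_abs_self _
    _ ≤ δ * S * ∑ x, ‖φ x‖ ^ 2 := hreal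

end Form

/-! ## §2  The hence-step (I.7.3.2) + (2.35) ⟹ (2.38), two explicit constants -/

section HenceStep

open Literature.MathematicalPhysics.QuantumFieldTheory.Balaban1983to89

variable {P : Params} {j : ℕ}

/-- **(2.38) from (I.7.3.2) and a form closeness**: r18's `Ineq238 c e_k p(e_k) form_Ω Adm u` for Δ_k(Ω,u) and
`|form_loc φ − form_Ω φ| ≤ η‖φ‖²` on admissible φ give `c·Σ_b|u(b)φ(b₊) − φ(b₋)|² − (c·e_k²p(e_k)² + η)·Σ_x|φ(x)|² ≤ form_loc φ`.
[cite: BalabanImbrieJaffe1988, (2.38) p.264] -/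
theorem ineq238_of_formClose {c ek pek η : ℝ} {formΩ formLoc : (Balaban1983to89.Site P j → ℂ) → ℝ}
    {Adm : (Balaban1983to89.Site P j → ℂ) → Prop} {u : PBond P j → ℂ} (h238 : Ineq238 c ek pek formΩ Adm u)
    (hclose : ∀ φ, Adm φ → |formLoc φ - formΩ φ| ≤ η * ∑ x : Balaban1983to89.Site P j, ‖φ x‖ ^ 2)
    (φ : Balaban1983to89.Site P j → ℂ) (hφ : Adm φ) :
    c * (∑ b : PBond P j, ‖u b * φ b.tgt - φ b.src‖ ^ 2)
        - (c * ek ^ 2 * pek ^ 2 + η) * (∑ x : Balaban1983to89.Site P j, ‖φ x‖ ^ 2) ≤ formLoc φ := by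
  have h1 := h238 φ hφ
  have h2 := neg_le_of_abs_le (hclose φ hφ)
  have h3 : (c * ek ^ 2 * pek ^ 2 + η) * (∑ x : Balaban1983to89.Site P j, ‖φ x‖ ^ 2)
      = c * ek ^ 2 * pek ^ 2 * (∑ x : Balaban1983to89.Site P j, ‖φ x‖ ^ 2)
        + η * (∑ x : Balaban1983to89.Site P j, ‖φ x‖ ^ 2) := by ring
  linarith

/-- **(2.38), the printed hence-step for complex kernels**: the lower bound (I.7.3.2) for `⟨φ, Δ_k(Ω,u)φ⟩ = kform Δ_Ω φ` and a kernel
closeness `‖Δ_loc(x,y) − Δ_Ω(x,y)‖ ≤ δe^{−c′dist(x,y)}` on `supp φ × supp φ` for admissible φ (print: *"φ supported in a region having an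
r(e_k) neighborhood where u is smooth"*, where (2.35) holds) give (2.38) for `Δ_{k,loc}` with the constants `(c, c·e_k²p(e_k)² + δS)`.
[cite: BalabanImbrieJaffe1988, (2.38) p.264] -/
theorem ineq238_loc_of_kernelClose {c ek pek δ c' S : ℝ} {dist : Balaban1983to89.Site P j → Balaban1983to89.Site P j → ℝ}
    {KΩ Kloc : Balaban1983to89.Site P j → Balaban1983to89.Site P j → ℂ} {Adm : (Balaban1983to89.Site P j → ℂ) → Prop}
    {u : PBond P j → ℂ} (h238 : Ineq238 c ek pek (kform KΩ) Adm u)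
    (hM : ∀ φ, Adm φ → ∀ x y, φ x ≠ 0 → φ y ≠ 0 → ‖Kloc x y - KΩ x y‖ ≤ δ * Real.exp (-c' * dist x y))
    (hsymm : ∀ x y, dist x y = dist y x) (hS : ∀ x, ∑ y, Real.exp (-c' * dist x y) ≤ S) (hδ : 0 ≤ δ)
    (φ : Balaban1983to89.Site P j → ℂ) (hφ : Adm φ) :
    c * (∑ b : PBond P j, ‖u b * φ b.tgt - φ b.src‖ ^ 2)
        - (c * ek ^ 2 * pek ^ 2 + δ * S) * (∑ x : Balaban1983to89.Site P j, ‖φ x‖ ^ 2) ≤ kform Kloc φ :=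
  ineq238_of_formClose h238 (fun ψ hψ => abs_kform_sub_le (hM ψ hψ) hsymm hS hδ) φ hφ

/-- **(2.38) FROM (2.35) AS TYPED** (r18's real kernels): `Ineq238 c e_k p(e_k) (rkform Δ_Ω) Adm u` ([I] (7.3.2)) and
`Close235 dist Far Δ_loc Δ_Ω c′ r(e_k)` ((2.35)) whose region `Far` contains `supp φ × supp φ` for every admissible φ give
`c·Σ_b|u(b)φ(b₊) − φ(b₋)|² − (c·e_k²p(e_k)² + e^{−c′r(e_k)}S)·Σ_x|φ(x)|² ≤ ⟨φ, Δ_{k,loc}φ⟩`. [cite: BalabanImbrieJaffe1988, (2.38) p.264] -/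
theorem ineq238_loc_of_close235 {c ek pek c' rek S : ℝ}
    {dist : Balaban1983to89.Site P j → Balaban1983to89.Site P j → ℝ}
    {Far : Balaban1983to89.Site P j → Balaban1983to89.Site P j → Prop}
    {KΩ Kloc : Balaban1983to89.Site P j → Balaban1983to89.Site P j → ℝ} {Adm : (Balaban1983to89.Site P j → ℂ) → Prop}
    {u : PBond P j → ℂ} (h238 : Ineq238 c ek pek (rkform KΩ) Adm u) (h235 : Close235 dist Far Kloc KΩ c' rek)
    (hAdm : ∀ φ, Adm φ → ∀ x y, φ x ≠ 0 → φ y ≠ 0 → Far x y)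
    (hsymm : ∀ x y, dist x y = dist y x) (hS : ∀ x, ∑ y, Real.exp (-c' * dist x y) ≤ S)
    (φ : Balaban1983to89.Site P j → ℂ) (hφ : Adm φ) :
    c * (∑ b : PBond P j, ‖u b * φ b.tgt - φ b.src‖ ^ 2)
        - (c * ek ^ 2 * pek ^ 2 + Real.exp (-c' * rek) * S) * (∑ x : Balaban1983to89.Site P j, ‖φ x‖ ^ 2)
          ≤ rkform Kloc φ := by
  refine ineq238_loc_of_kernelClose (KΩ := fun x y => (KΩ x y : ℂ)) (Kloc := fun x y => (Kloc x y : ℂ)) h238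
    (fun ψ hψ x y hx hy => ?_) hsymm hS (Real.exp_pos _).le φ hφ
  rw [← Complex.ofReal_sub, Complex.norm_real, Real.norm_eq_abs]
  exact h235 x y (hAdm ψ hψ x y hx hy)

end HenceStep

end

end Literature.MathematicalPhysics.QuantumFieldTheory.BalabanImbrieJaffe1984to88.BIJ88Ineq238Proof
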